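import Literature.Topology.FourManifolds.SphereFamilySurgeryTransport
import Literature.Topology.FourManifolds.SmoothEmbeddingComp
import Literature.Topology.FourManifolds.FibreStraightening
import Mathlib.Analysis.InnerProductSpace.Calculus
import HarnessLib

/-!
# Squeezing the fibres of a framed sphere family into a bounded tube without changing the surgery

Topic `Literature/Topology/FourManifolds` (fact seat
`provefact-Literature.Topology.FourManifolds.Matvey-69322e0896`, rung (H4)
`Literature.Topology.FourManifolds.Matveyev1996_partOne_and_fact_of_dualSpheres` of
`CorkDecompositionMiddleLevel.lean`; vocabulary of `SphereFamilySurgery.lean`).  Milnor,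
*Lectures on the h-cobordism theorem* (1965), Def. 3.11 (PDF p. 17): the surgered manifold
`χ(V, φ)` is glued from `V ∖ S` and `OD^{k+1} × Sˡ` by identifying *"`φ(u, θv)` with `(θu, v)`
for each `u ∈ S^{λ-1}`, `v ∈ S^{n-λ}`, `0 < θ < 1`"* — only the **open unit tube** of the
characteristic embedding `φ : Sᵏ × ℝˡ⁺¹ → V` enters.  Matveyev 1996 (arXiv:dg-ga/9505001),
step 3, performs the surgeries inside a compact domain `V₃ ⊂ N`; to read a framed family of `N`
whose closed unit tubes lie in a regular domain `{g < 0}` as a framed family *of the domain*,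
its unbounded fibres `ℝˡ⁺¹` must first be squeezed into a bounded tube.  This file does so
without touching Milnor's identification: with `R > 1`, `c = √(R² - 1)` and the radial
diffeomorphism `sq_R(w) = univBall 0 R (c⁻¹ w) = R w / √(R² - 1 + ‖w‖²)` of `ℝᵐ` onto the open
ball of radius `R` — which is **the identity on the unit sphere** and maps the open unit ball
onto itself — the family `φ'(v, w) = φ(v, sq_R w)` has the same core spheres, its tubes are the
`R`-tubes of `φ`, and every manifold obtained by surgery along `φ` is obtained by surgery along
`φ'` (the embedding of the new piece is reparametrised by `(i, y, u) ↦ (i, sq_R y, u)`, a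
self-diffeomorphism of `ι × OD^{k+1} × Sˡ`, under which Milnor's relation for `φ` becomes
Milnor's relation for `φ'`, `θ ↦ R θ / √(R² - 1 + θ²)`).  Everything here is proved; no
definitions, no named facts:

* `univBall_inv_smul_eq_smul`, `norm_univBall_inv_smul`, `norm_univBall_inv_smul_lt_one_iff`,
  `univBall_inv_smul_smul_of_norm_eq_one` — the closed form, the norm, and the polar form of
  `sq_R`;
* `Literature.Topology.FourManifolds.FramedSphereFamily.exists_squeeze` — the squeezed family
  `φ'(v, w) = φ(v, sq_R w)`, with `range φ'ᵢ = φᵢ(Sᵏ × B(0, R))`;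
* `Literature.Topology.FourManifolds.FramedSphereFamily.sphere_eq_of_squeeze`,
  `cores_eq_of_squeeze`, `complement_eq_of_squeeze`;
* **`Literature.Topology.FourManifolds.FramedSphereFamily.IsSurgery.of_squeeze`** — surgery
  along `φ` is surgery along `φ'`.

## References

* J. Milnor, *Lectures on the h-cobordism theorem*, notes by L. Siebenmann and J. Sondow,
  Princeton (1965), Def. 3.11 (PDF p. 17), §3 (PDF p. 21). [MilnorHCobordism1965]
* R. Matveyev, *A decomposition of smooth simply-connected h-cobordant 4-manifolds*,
  arXiv:dg-ga/9505001, Proof of Theorem, step 3 (arXiv p. 2). [Matveyev1996]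
* A. Kosinski, *Differential Manifolds* (1993), VI.6 (surgery is well defined). [Kosinski1993]
-/

noncomputable section

open scoped Manifold ContDiff Topology
open Set Function Metric OpenPartialHomeomorph

namespace Literature.Topology.FourManifolds

universe u

/-! ### The radial squeeze `sq_R(w) = univBall 0 R (c⁻¹ w)`, `c = √(R² - 1)` -/

section Squeeze

variable {E : Type*} [NormedAddCommGroup E] [InnerProductSpace ℝ E]

/-- `c = √(R² - 1)` is positive for `R > 1`. [folklore] -/
theorem sqrt_sq_sub_one_pos {R : ℝ} (hR : 1 < R) : 0 < Real.sqrt (R ^ 2 - 1) :=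
  Real.sqrt_pos.2 (by nlinarith)

/-- **Closed form of the squeeze**: `univBall 0 R (c⁻¹ w) = (R / √(R² - 1 + ‖w‖²)) w`.
[folklore] -/
theorem univBall_inv_smul_eq_smul {R : ℝ} (hR : 1 < R) (w : E) :
    univBall (0 : E) R ((Real.sqrt (R ^ 2 - 1))⁻¹ • w) =
      (R / Real.sqrt (R ^ 2 - 1 + ‖w‖ ^ 2)) • w := by
  have hc := sqrt_sq_sub_one_pos hR
  have hR0 : 0 < R := by linarith
  set c := Real.sqrt (R ^ 2 - 1) with hcdef
  have hc2 : c ^ 2 = R ^ 2 - 1 := Real.sq_sqrt (by nlinarith)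
  rw [univBall_zero_eq_smul hR0, smul_smul, smul_smul]
  congr 1
  have hn : ‖c⁻¹ • w‖ ^ 2 = ‖w‖ ^ 2 / c ^ 2 := by
    rw [norm_smul, norm_inv, Real.norm_of_nonneg hc.le, mul_pow, inv_pow, div_eq_inv_mul]
  have hkey : Real.sqrt (1 + ‖c⁻¹ • w‖ ^ 2) * c = Real.sqrt (R ^ 2 - 1 + ‖w‖ ^ 2) := by
    have h1 : (1 + ‖w‖ ^ 2 / c ^ 2) * c ^ 2 = R ^ 2 - 1 + ‖w‖ ^ 2 := by
      rw [add_mul, one_mul, div_mul_cancel₀ _ (pow_ne_zero 2 hc.ne'), hc2]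
    rw [hn, ← h1, Real.sqrt_mul (by positivity) (c ^ 2), Real.sqrt_sq hc.le]
  have hpos : 0 < Real.sqrt (1 + ‖c⁻¹ • w‖ ^ 2) := Real.sqrt_pos.2 (by positivity)
  rw [← hkey]
  field_simp

/-- **The norm of the squeeze**: `‖univBall 0 R (c⁻¹ w)‖ = R ‖w‖ / √(R² - 1 + ‖w‖²)`.
[folklore] -/
theorem norm_univBall_inv_smul {R : ℝ} (hR : 1 < R) (w : E) :
    ‖univBall (0 : E) R ((Real.sqrt (R ^ 2 - 1))⁻¹ • w)‖ =
      R * ‖w‖ / Real.sqrt (R ^ 2 - 1 + ‖w‖ ^ 2) := by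
  have hR0 : 0 < R := by linarith
  have hs : 0 < Real.sqrt (R ^ 2 - 1 + ‖w‖ ^ 2) := Real.sqrt_pos.2 (by nlinarith [norm_nonneg w])
  rw [univBall_inv_smul_eq_smul hR, norm_smul, Real.norm_of_nonneg (div_nonneg hR0.le hs.le)]
  ring

/-- The one-variable inequality behind the squeeze: for `R > 1` and `t ≥ 0`,
`R t < √(R² - 1 + t²) ↔ t < 1`. [folklore] -/
theorem mul_lt_sqrt_sq_sub_one_add_iff {R : ℝ} (hR : 1 < R) {t : ℝ} (ht : 0 ≤ t) :
    R * t < Real.sqrt (R ^ 2 - 1 + t ^ 2) ↔ t < 1 := by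
  have hR0 : 0 < R := by linarith
  have hid : R ^ 2 - 1 + t ^ 2 - (R * t) ^ 2 = (R ^ 2 - 1) * (1 - t ^ 2) := by ring
  have hR1 : 0 < R ^ 2 - 1 := by nlinarith
  constructor
  · intro h
    by_contra hle
    rw [not_lt] at hle
    have h1 : 1 - t ^ 2 ≤ 0 := by nlinarith
    have h2 : R ^ 2 - 1 + t ^ 2 ≤ (R * t) ^ 2 := by
      nlinarith [mul_nonpos_iff.2 (Or.inl ⟨hR1.le, h1⟩)]
    have h3 : Real.sqrt (R ^ 2 - 1 + t ^ 2) ≤ R * t := by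
      calc Real.sqrt (R ^ 2 - 1 + t ^ 2) ≤ Real.sqrt ((R * t) ^ 2) := Real.sqrt_le_sqrt h2
        _ = R * t := Real.sqrt_sq (by positivity)
    linarith
  · intro h
    have h1 : 0 < 1 - t ^ 2 := by nlinarith
    have h2 : (R * t) ^ 2 < R ^ 2 - 1 + t ^ 2 := by nlinarith [mul_pos hR1 h1]
    exact (Real.lt_sqrt (by positivity)).2 h2

/-- For `R > 1` and `0 ≤ t ≤ 1`, `R t ≤ √(R² - 1 + t²)`. [folklore] -/
theorem mul_le_sqrt_sq_sub_one_add {R : ℝ} (hR : 1 < R) {t : ℝ} (ht : 0 ≤ t) (ht1 : t ≤ 1) :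
    R * t ≤ Real.sqrt (R ^ 2 - 1 + t ^ 2) := by
  have hR0 : 0 < R := by linarith
  have hR1 : 0 < R ^ 2 - 1 := by nlinarith
  have h1 : 0 ≤ 1 - t ^ 2 := by nlinarith
  have h2 : (R * t) ^ 2 ≤ R ^ 2 - 1 + t ^ 2 := by nlinarith [mul_nonneg hR1.le h1]
  exact Real.le_sqrt_of_sq_le h2

/-- The radial coefficient `R θ / √(R² - 1 + θ²)` is `< 1` iff `θ < 1` (`θ ≥ 0`). [folklore] -/
theorem mul_div_sqrt_lt_one_iff {R : ℝ} (hR : 1 < R) {θ : ℝ} (hθ : 0 ≤ θ) :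
    R * θ / Real.sqrt (R ^ 2 - 1 + θ ^ 2) < 1 ↔ θ < 1 := by
  have hs : 0 < Real.sqrt (R ^ 2 - 1 + θ ^ 2) := Real.sqrt_pos.2 (by nlinarith)
  rw [div_lt_one hs]
  exact mul_lt_sqrt_sq_sub_one_add_iff hR hθ

/-- The radial coefficient `R θ / √(R² - 1 + θ²)` is positive for `θ > 0`. [folklore] -/
theorem mul_div_sqrt_pos {R : ℝ} (hR : 1 < R) {θ : ℝ} (hθ : 0 < θ) :
    0 < R * θ / Real.sqrt (R ^ 2 - 1 + θ ^ 2) :=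
  div_pos (mul_pos (by linarith) hθ) (Real.sqrt_pos.2 (by nlinarith))

/-- **The squeeze preserves the open unit ball**: `‖univBall 0 R (c⁻¹ w)‖ < 1 ↔ ‖w‖ < 1`.
[folklore] -/
theorem norm_univBall_inv_smul_lt_one_iff {R : ℝ} (hR : 1 < R) (w : E) :
    ‖univBall (0 : E) R ((Real.sqrt (R ^ 2 - 1))⁻¹ • w)‖ < 1 ↔ ‖w‖ < 1 := by
  have hs : 0 < Real.sqrt (R ^ 2 - 1 + ‖w‖ ^ 2) := Real.sqrt_pos.2 (by nlinarith [norm_nonneg w])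
  rw [norm_univBall_inv_smul hR, div_lt_one hs]
  exact mul_lt_sqrt_sq_sub_one_add_iff hR (norm_nonneg w)

/-- The squeeze maps the closed unit ball into itself. [folklore] -/
theorem norm_univBall_inv_smul_le_one {R : ℝ} (hR : 1 < R) {w : E} (hw : ‖w‖ ≤ 1) :
    ‖univBall (0 : E) R ((Real.sqrt (R ^ 2 - 1))⁻¹ • w)‖ ≤ 1 := by
  have hs : 0 < Real.sqrt (R ^ 2 - 1 + ‖w‖ ^ 2) := Real.sqrt_pos.2 (by nlinarith [norm_nonneg w])
  rw [norm_univBall_inv_smul hR, div_le_one hs]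
  exact mul_le_sqrt_sq_sub_one_add hR (norm_nonneg w) hw

/-- **Polar form of the squeeze**: for a unit vector `u` and `θ ≥ 0`,
`univBall 0 R (c⁻¹ (θ u)) = (R θ / √(R² - 1 + θ²)) u`. [folklore] -/
theorem univBall_inv_smul_smul_of_norm_eq_one {R : ℝ} (hR : 1 < R) {u : E} (hu : ‖u‖ = 1)
    {θ : ℝ} (hθ : 0 ≤ θ) :
    univBall (0 : E) R ((Real.sqrt (R ^ 2 - 1))⁻¹ • (θ • u)) =
      (R * θ / Real.sqrt (R ^ 2 - 1 + θ ^ 2)) • u := by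
  rw [univBall_inv_smul_eq_smul hR, smul_smul, norm_smul, hu, mul_one, Real.norm_of_nonneg hθ]
  ring_nf

/-- The squeeze is `C^∞`. [folklore] -/
theorem contDiff_univBall_inv_smul (R : ℝ) :
    ContDiff ℝ ∞ fun w : E => univBall (0 : E) R ((Real.sqrt (R ^ 2 - 1))⁻¹ • w) :=
  contDiff_univBall.comp (contDiff_const_smul _)

/-- **The squeeze as a globally defined partial diffeomorphism `ℝᵐ ⇀ ℝᵐ` onto the open ball of
radius `R`** (inverse `z ↦ c · (univBall 0 R)⁻¹ z`). [folklore] -/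
theorem exists_openPartialHomeomorph_univBall_inv_smul {R : ℝ} (hR : 1 < R) :
    ∃ Ψ : OpenPartialHomeomorph E E, Ψ.source = univ ∧ Ψ.target = ball 0 R ∧
      (∀ w, Ψ w = univBall (0 : E) R ((Real.sqrt (R ^ 2 - 1))⁻¹ • w)) ∧
      ContDiff ℝ ∞ Ψ ∧ ContDiffOn ℝ ∞ Ψ.symm Ψ.target := by
  have hc := sqrt_sq_sub_one_pos hR
  have hR0 : 0 < R := by linarith
  set c := Real.sqrt (R ^ 2 - 1) with hcdef
  have htgt : (univBall (0 : E) R).target = ball 0 R := univBall_target 0 hR0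
  refine ⟨{ toFun := fun w => univBall (0 : E) R (c⁻¹ • w)
            invFun := fun z => c • (univBall (0 : E) R).symm z
            source := univ
            target := ball 0 R
            map_source' := fun w _ => by
              rw [← htgt]
              exact (univBall (0 : E) R).map_source (by rw [univBall_source]; exact mem_univ _)
            map_target' := fun z _ => mem_univ _
            left_inv' := fun w _ => by
              show c • (univBall (0 : E) R).symm (univBall (0 : E) R (c⁻¹ • w)) = w
              rw [(univBall (0 : E) R).left_inv (by rw [univBall_source]; exact mem_univ _),
                smul_smul, mul_inv_cancel₀ hc.ne', one_smul]
            right_inv' := fun z hz => by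
              show univBall (0 : E) R (c⁻¹ • c • (univBall (0 : E) R).symm z) = z
              rw [smul_smul, inv_mul_cancel₀ hc.ne', one_smul,
                (univBall (0 : E) R).right_inv (by rw [htgt]; exact hz)]
            open_source := isOpen_univ
            open_target := isOpen_ball
            continuousOn_toFun :=
              ((univBall (0 : E) R).continuousOn.comp_continuous (continuous_const_smul _)
                fun w => by rw [univBall_source]; exact mem_univ _).continuousOn
            continuousOn_invFun := by
              refine (continuousOn_const.smul ?_)
              rw [← htgt]
              exact (univBall (0 : E) R).continuousOn_symm }, rfl, rfl, fun w => rfl,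
    contDiff_univBall_inv_smul R, ?_⟩
  show ContDiffOn ℝ ∞ (fun z => c • (univBall (0 : E) R).symm z) (ball 0 R)
  exact contDiffOn_const.smul contDiffOn_univBall_symm

end Squeeze

/-! ### The squeezed family -/

namespace FramedSphereFamily

variable {EX HX : Type*} [NormedAddCommGroup EX] [NormedSpace ℝ EX] [TopologicalSpace HX]
  {IX : ModelWithCorners ℝ EX HX} {X : Type*} [TopologicalSpace X] [ChartedSpace HX X]
  {ι : Type u} {k m : ℕ}

/-- **Squeezing the fibres** (Milnor 1965, Def. 3.11, freedom in the characteristic embedding):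
for a framed family `φ` and `R > 1` there is a framed family `φ'` with
`φ'ᵢ(v, w) = φᵢ(v, sq_R w)`, `sq_R(w) = univBall 0 R (c⁻¹ w)`, whose tubes are the `R`-tubes of
`φ`: `range φ'ᵢ = φᵢ(Sᵏ × B(0, R))`. [cite: MilnorHCobordism1965, Def. 3.11 (PDF p. 17)] -/
theorem exists_squeeze (ν : FramedSphereFamily IX X ι k m) {R : ℝ} (hR : 1 < R) :
    ∃ ν' : FramedSphereFamily IX X ι k m,
      (∀ i v w, ν'.toFun i (v, w) =
        ν.toFun i (v, univBall (0 : EuclideanSpace ℝ (Fin m)) R ((Real.sqrt (R ^ 2 - 1))⁻¹ • w))) ∧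
      ∀ i, range (ν'.toFun i) = ν.toFun i '' (univ ×ˢ ball 0 R) := by
  obtain ⟨Ψ, hΨs, hΨt, hΨ, hΨc, hΨc'⟩ :=
    exists_openPartialHomeomorph_univBall_inv_smul (E := EuclideanSpace ℝ (Fin m)) hR
  -- the squeeze on `Sᵏ × ℝᵐ` as a globally defined partial homeomorphism
  set Φ : OpenPartialHomeomorph
      (Metric.sphere (0 : EuclideanSpace ℝ (Fin (k + 1))) 1 × EuclideanSpace ℝ (Fin m))
      (Metric.sphere (0 : EuclideanSpace ℝ (Fin (k + 1))) 1 × EuclideanSpace ℝ (Fin m)) :=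
    (OpenPartialHomeomorph.refl _).prod Ψ with hΦ_def
  have hΦ : ∀ q, Φ q = (q.1, Ψ q.2) := fun q => rfl
  have hΦs' : ∀ q, Φ.symm q = (q.1, Ψ.symm q.2) := fun q => rfl
  have hsrc : Φ.source = univ := by
    rw [hΦ_def, OpenPartialHomeomorph.prod_source, OpenPartialHomeomorph.refl_source, hΨs,
      univ_prod_univ]
  have htgt : Φ.target = univ ×ˢ ball 0 R := by
    rw [hΦ_def, OpenPartialHomeomorph.prod_target, OpenPartialHomeomorph.refl_target, hΨt]
  have hΨm : ContMDiff (𝓡 m) (𝓡 m) ∞ Ψ := hΨc.contMDiff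
  have hsm : ContMDiffOn ((𝓡 k).prod (𝓡 m)) ((𝓡 k).prod (𝓡 m)) ∞ Φ Φ.source := by
    have h : ContMDiff ((𝓡 k).prod (𝓡 m)) ((𝓡 k).prod (𝓡 m)) ∞
        fun q : Metric.sphere (0 : EuclideanSpace ℝ (Fin (k + 1))) 1 × EuclideanSpace ℝ (Fin m) =>
          (q.1, Ψ q.2) :=
      contMDiff_fst.prodMk (hΨm.comp contMDiff_snd)
    exact h.contMDiffOn.congr fun q _ => hΦ q
  have hsm' : ContMDiffOn ((𝓡 k).prod (𝓡 m)) ((𝓡 k).prod (𝓡 m)) ∞ Φ.symm Φ.target := by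
    rw [htgt]
    have h2 : ContMDiffOn ((𝓡 k).prod (𝓡 m)) (𝓡 m) ∞
        (fun q : Metric.sphere (0 : EuclideanSpace ℝ (Fin (k + 1))) 1 × EuclideanSpace ℝ (Fin m) =>
          Ψ.symm q.2) (univ ×ˢ ball 0 R) := by
      have h3 : ContMDiffOn (𝓡 m) (𝓡 m) ∞ Ψ.symm (ball 0 R) := by
        rw [← hΨt]; exact hΨc'.contMDiffOn
      exact h3.comp contMDiffOn_snd fun q hq => hq.2
    exact (contMDiffOn_fst.prodMk h2).congr fun q _ => hΦs' q
  have hrange : ∀ i,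
      range (fun q : Metric.sphere (0 : EuclideanSpace ℝ (Fin (k + 1))) 1 × EuclideanSpace ℝ (Fin
          m) =>
        ν.toFun i (q.1, Ψ q.2)) = ν.toFun i '' (univ ×ˢ ball 0 R) := fun i => by
    rw [← htgt, show (fun q : Metric.sphere (0 : EuclideanSpace ℝ (Fin (k + 1))) 1 ×
        EuclideanSpace ℝ (Fin m) => ν.toFun i (q.1, Ψ q.2)) = ν.toFun i ∘ Φ from rfl,
      Φ.range_comp_eq_image_target hsrc]
  have hopen : ∀ i, Topology.IsOpenEmbedding (ν.toFun i) := fun i =>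
    ⟨(ν.isSmoothEmbedding i).isEmbedding, ν.isOpen_range i⟩
  refine ⟨{ toFun := fun i q => ν.toFun i (q.1, Ψ q.2)
            isSmoothEmbedding := fun i =>
              (ν.isSmoothEmbedding i).comp_openPartialHomeomorph Φ hsrc hsm hsm'
            isOpen_range := fun i => by
              rw [hrange i]
              exact (hopen i).isOpenMap _ (isOpen_univ.prod isOpen_ball)
            disjoint_range := fun i j hij => by
              refine Set.disjoint_of_subset ?_ ?_ (ν.disjoint_range hij)
              · rintro _ ⟨q, rfl⟩
                exact ⟨_, rfl⟩
              · rintro _ ⟨q, rfl⟩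
                exact ⟨_, rfl⟩ }, fun i v w => by rw [← hΨ], hrange⟩

variable {ν ν' : FramedSphereFamily IX X ι k m} {R : ℝ}

/-- A squeezed family has the same core spheres (`sq_R 0 = 0`).
[cite: MilnorHCobordism1965, Def. 3.9, Def. 3.11 (PDF pp. 16–17)] -/
theorem sphere_eq_of_squeeze
    (h : ∀ i v w, ν'.toFun i (v, w) =
      ν.toFun i (v, univBall (0 : EuclideanSpace ℝ (Fin m)) R ((Real.sqrt (R ^ 2 - 1))⁻¹ • w)))
    (i : ι) : ν'.sphere i = ν.sphere i := by
  funext v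
  rw [sphere_apply, sphere_apply, h, smul_zero, univBall_apply_zero]

/-- A squeezed family has the same cores. [cite: MilnorHCobordism1965, Def. 3.11 (PDF p. 17)] -/
theorem cores_eq_of_squeeze
    (h : ∀ i v w, ν'.toFun i (v, w) =
      ν.toFun i (v, univBall (0 : EuclideanSpace ℝ (Fin m)) R ((Real.sqrt (R ^ 2 - 1))⁻¹ • w))) :
    ν'.cores = ν.cores := by
  simp only [cores, sphere_eq_of_squeeze h]

/-- A squeezed family has the same complement of the cores.
[cite: MilnorHCobordism1965, Def. 3.11 (PDF p. 17)] -/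
theorem complement_eq_of_squeeze [T2Space X] [Finite ι]
    (h : ∀ i v w, ν'.toFun i (v, w) =
      ν.toFun i (v, univBall (0 : EuclideanSpace ℝ (Fin m)) R ((Real.sqrt (R ^ 2 - 1))⁻¹ • w))) :
    ν'.complement = ν.complement :=
  TopologicalSpace.Opens.ext (congrArg compl (cores_eq_of_squeeze h))

end FramedSphereFamily

/-! ### Surgery along the squeezed family -/

section SqueezeSurgery

namespace FramedSphereFamily

variable {EX HX : Type*} [NormedAddCommGroup EX] [NormedSpace ℝ EX] [TopologicalSpace HX]
  {IX : ModelWithCorners ℝ EX HX} {X : Type*} [TopologicalSpace X] [ChartedSpace HX X]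
  [T2Space X] {ι : Type u} [Finite ι] {k l : ℕ}
  {EP HP : Type*} [NormedAddCommGroup EP] [NormedSpace ℝ EP] [TopologicalSpace HP]
  {IP : ModelWithCorners ℝ EP HP} {P : Type*} [TopologicalSpace P] [ChartedSpace HP P]
  {ν ν' : FramedSphereFamily IX X ι k (l + 1)} {R : ℝ}

/-- **Squeezing the fibres does not change the surgery** (Milnor 1965, Def. 3.11: the
identification *"`φ(u, θv)` with `(θu, v)`, `0 < θ < 1`"* involves only the open unit tube).
If `P` is obtained from `X` by surgery along `φ` and `φ'(v, w) = φ(v, sq_R w)` is the squeezed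
family (`exists_squeeze`, `R > 1`), then `P` is obtained from `X` by surgery along `φ'`: keep the
gluing embedding `jA` of `X ∖ cores` (the cores are the same) and replace the embedding `jB` of
the new piece `ι × OD^{k+1} × Sˡ` by `jB ∘ σ`, `σ(i, y, u) = (i, sq_R y, u)`, a
self-diffeomorphism of the new piece (`sq_R` preserves the open unit ball); under `σ` Milnor's
relation for `φ` becomes Milnor's relation for `φ'` (`θ ↦ R θ / √(R² - 1 + θ²)`).
[cite: MilnorHCobordism1965, Def. 3.11 (PDF p. 17), §3 (PDF p. 21)] -/
theorem IsSurgery.of_squeeze (hν : ν.IsSurgery IP P)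
    (h : ∀ i v w, ν'.toFun i (v, w) =
      ν.toFun i (v, univBall (0 : EuclideanSpace ℝ (Fin (l + 1))) R
        ((Real.sqrt (R ^ 2 - 1))⁻¹ • w)))
    (hR : 1 < R) : ν'.IsSurgery IP P := by
  have hc : ν'.complement = ν.complement := complement_eq_of_squeeze h
  unfold FramedSphereFamily.IsSurgery at hν ⊢
  delta sphereFamilySurgeryRel at hν ⊢
  rw [hc]
  obtain ⟨jA, jB, hA, hAo, hB, hBo, hU, hRel⟩ := hν
  obtain ⟨Ψ, hΨs, hΨt, hΨ, hΨc, hΨc'⟩ :=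
    exists_openPartialHomeomorph_univBall_inv_smul (E := EuclideanSpace ℝ (Fin (k + 1))) hR
  have hΨm : ContMDiff (𝓡 (k + 1)) (𝓡 (k + 1)) ∞ Ψ := hΨc.contMDiff
  have hΨball : ∀ y : EuclideanSpace ℝ (Fin (k + 1)), ‖Ψ y‖ < 1 ↔ ‖y‖ < 1 := fun y => by
    rw [hΨ]; exact norm_univBall_inv_smul_lt_one_iff hR y
  have hΨmem : ∀ y : EuclideanSpace ℝ (Fin (k + 1)), Ψ y ∈ Ψ.target := fun y =>
    Ψ.map_source (by rw [hΨs]; exact mem_univ y)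
  -- the self-map `σ(i, y, u) = (i, sq_R y, u)` of the new piece and its inverse
  set f := fun q : DiscreteIndex ι × (EuclideanSpace ℝ (Fin (k + 1)) ×
      Metric.sphere (0 : EuclideanSpace ℝ (Fin (l + 1))) 1) => (q.1, Ψ q.2.1, q.2.2) with hf
  set g := fun q : DiscreteIndex ι × (EuclideanSpace ℝ (Fin (k + 1)) ×
      Metric.sphere (0 : EuclideanSpace ℝ (Fin (l + 1))) 1) => (q.1, Ψ.symm q.2.1, q.2.2) with hg
  have hgf : ∀ q, g (f q) = q := fun q => by
    simp only [hf, hg, Ψ.left_inv (show q.2.1 ∈ Ψ.source by rw [hΨs]; exact mem_univ _)]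
  have hfg : ∀ q, ‖q.2.1‖ < 1 → f (g q) = q := fun q hq => by
    have hq' : q.2.1 ∈ Ψ.target := by
      rw [hΨt]; exact mem_ball_zero_iff.2 (hq.trans hR)
    simp only [hf, hg, Ψ.right_inv hq']
  have hfc : Continuous f :=
    continuous_fst.prodMk ((hΨc.continuous.comp (continuous_fst.comp continuous_snd)).prodMk
      (continuous_snd.comp continuous_snd))
  have hgc : ContinuousOn g {q | ‖q.2.1‖ < 1} := by
    refine continuousOn_fst.prodMk ((Ψ.continuousOn_symm.comp
      (continuous_fst.comp continuous_snd).continuousOn fun q hq => ?_).prodMk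
      (continuous_snd.comp continuous_snd).continuousOn)
    rw [hΨt]; exact mem_ball_zero_iff.2 (lt_trans hq hR)
  have hfs : ContMDiff ((𝓡 0).prod ((𝓡 (k + 1)).prod (𝓡 l)))
      ((𝓡 0).prod ((𝓡 (k + 1)).prod (𝓡 l))) ∞ f :=
    contMDiff_fst.prodMk ((hΨm.comp (contMDiff_fst.comp contMDiff_snd)).prodMk
      (contMDiff_snd.comp contMDiff_snd))
  have hgs : ContMDiffOn ((𝓡 0).prod ((𝓡 (k + 1)).prod (𝓡 l)))
      ((𝓡 0).prod ((𝓡 (k + 1)).prod (𝓡 l))) ∞ g {q | ‖q.2.1‖ < 1} := by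
    have h3 : ContMDiffOn (𝓡 (k + 1)) (𝓡 (k + 1)) ∞ Ψ.symm (ball 0 R) := by
      rw [← hΨt]; exact hΨc'.contMDiffOn
    refine contMDiffOn_fst.prodMk ((h3.comp (contMDiff_fst.comp contMDiff_snd).contMDiffOn
      fun q hq => ?_).prodMk (contMDiff_snd.comp contMDiff_snd).contMDiffOn)
    exact mem_ball_zero_iff.2 (lt_trans hq hR)
  have hfB : ∀ b : ↥(ballTimesSphere ι k l), f b ∈ ballTimesSphere ι k l := fun b => by
    show ‖Ψ b.1.2.1‖ < 1
    rw [hΨball]; exact b.2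
  have hgB : ∀ b : ↥(ballTimesSphere ι k l), g b ∈ ballTimesSphere ι k l := fun b => by
    show ‖Ψ.symm b.1.2.1‖ < 1
    have hb : ‖b.1.2.1‖ < 1 := b.2
    rw [← hΨball, Ψ.right_inv (by rw [hΨt]; exact mem_ball_zero_iff.2 (hb.trans hR))]
    exact hb
  set σ : OpenPartialHomeomorph ↥(ballTimesSphere ι k l) ↥(ballTimesSphere ι k l) :=
    { toFun := fun b => ⟨f b, hfB b⟩
      invFun := fun b => ⟨g b, hgB b⟩
      source := univ
      target := univ
      map_source' := fun b _ => mem_univ _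
      map_target' := fun b _ => mem_univ _
      left_inv' := fun b _ => Subtype.ext (hgf b)
      right_inv' := fun b _ => Subtype.ext (hfg b b.2)
      open_source := isOpen_univ
      open_target := isOpen_univ
      continuousOn_toFun := ((hfc.comp continuous_subtype_val).subtype_mk _).continuousOn
      continuousOn_invFun :=
        ((hgc.comp_continuous continuous_subtype_val fun b => b.2).subtype_mk _).continuousOn }
    with hσdef
  have hσs : ContMDiffOn ((𝓡 0).prod ((𝓡 (k + 1)).prod (𝓡 l)))
      ((𝓡 0).prod ((𝓡 (k + 1)).prod (𝓡 l))) ∞ σ σ.source := by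
    have : ContMDiff ((𝓡 0).prod ((𝓡 (k + 1)).prod (𝓡 l)))
        ((𝓡 0).prod ((𝓡 (k + 1)).prod (𝓡 l))) ∞
        (σ : ↥(ballTimesSphere ι k l) → ↥(ballTimesSphere ι k l)) :=
      (ContMDiff.subtypeVal_comp_iff (ballTimesSphere ι k l) _).1 (hfs.comp contMDiff_subtype_val)
    exact this.contMDiffOn
  have hσs' : ContMDiffOn ((𝓡 0).prod ((𝓡 (k + 1)).prod (𝓡 l)))
      ((𝓡 0).prod ((𝓡 (k + 1)).prod (𝓡 l))) ∞ σ.symm σ.target := by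
    intro b _
    have h1 : ContMDiffWithinAt ((𝓡 0).prod ((𝓡 (k + 1)).prod (𝓡 l)))
        ((𝓡 0).prod ((𝓡 (k + 1)).prod (𝓡 l))) ∞ (Subtype.val ∘ σ.symm) σ.target b :=
      ((hgs.comp_contMDiff contMDiff_subtype_val fun b => b.2).contMDiffAt).contMDiffWithinAt
    exact (ContMDiffWithinAt.subtypeVal_comp_iff (ballTimesSphere ι k l) σ.symm σ.target b).1 h1
  -- the new gluing embedding of the new piece
  have hBσ : Manifold.IsSmoothEmbedding ((𝓡 0).prod ((𝓡 (k + 1)).prod (𝓡 l))) IP ∞ (jB ∘ σ) :=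
    hB.comp_openPartialHomeomorph σ rfl hσs hσs'
  have hBσo : IsOpen (range (jB ∘ σ)) := by
    rw [σ.range_comp_eq_image_target rfl, show σ.target = univ from rfl, image_univ]
    exact hBo
  refine ⟨jA, jB ∘ σ, hA, hAo, hBσ, hBσo, ?_, ?_⟩
  · -- the two pieces still cover `P` (`σ` is onto)
    refine eq_univ_of_forall fun p => ?_
    rcases (eq_univ_iff_forall.1 hU p) with ⟨a, rfl⟩ | ⟨b, rfl⟩
    · exact Or.inl ⟨a, rfl⟩
    · refine Or.inr ⟨σ.symm b, ?_⟩
      show jB (σ (σ.symm b)) = jB b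
      rw [σ.right_inv (show b ∈ σ.target from mem_univ _)]
  · -- Milnor's relation for `φ` read through `σ` is Milnor's relation for `φ'`
    intro a b
    rw [comp_apply, hRel a (σ b)]
    have hσb1 : (σ b).1.1 = b.1.1 := rfl
    have hσb2 : (σ b).1.2.1 = Ψ b.1.2.1 := rfl
    have hσb3 : (σ b).1.2.2 = b.1.2.2 := rfl
    simp only [hσb1, hσb2, hσb3, h, hΨ]
    have hR0 : (0 : ℝ) < R := by linarith
    constructor
    · rintro ⟨v, θ', hθ', hy, ha⟩
      -- `b.y = θ v` with `θ = ‖b.y‖`, and `sq_R (θ u) = θ' u`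
      set θ := ‖b.1.2.1‖ with hθdef
      have hy0 : b.1.2.1 ≠ 0 := by
        intro h0
        rw [h0, smul_zero, univBall_apply_zero] at hy
        have := congrArg norm hy
        rw [norm_zero, norm_smul, Real.norm_of_nonneg hθ'.1.le, norm_eq_of_mem_sphere v,
          mul_one] at this
        linarith [hθ'.1]
      have hθ0 : 0 < θ := norm_pos_iff.2 hy0
      have hθ1 : θ < 1 := b.2
      have hpol : b.1.2.1 = θ • (θ⁻¹ • b.1.2.1) := by
        rw [smul_smul, mul_inv_cancel₀ hθ0.ne', one_smul]
      have hunit : ‖θ⁻¹ • b.1.2.1‖ = 1 := by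
        rw [norm_smul, norm_inv, Real.norm_of_nonneg hθ0.le, inv_mul_cancel₀ hθ0.ne']
      have hsq : univBall (0 : EuclideanSpace ℝ (Fin (k + 1))) R
          ((Real.sqrt (R ^ 2 - 1))⁻¹ • b.1.2.1) =
          (R * θ / Real.sqrt (R ^ 2 - 1 + θ ^ 2)) • (θ⁻¹ • b.1.2.1) := by
        conv_lhs => rw [hpol]
        exact univBall_inv_smul_smul_of_norm_eq_one hR hunit hθ0.le
      -- compare with `θ' • v`: same norm, same direction
      have hcoef : R * θ / Real.sqrt (R ^ 2 - 1 + θ ^ 2) = θ' := by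
        have h1 := congrArg norm hy
        rw [hsq, norm_smul, hunit, mul_one, norm_smul, norm_eq_of_mem_sphere v, mul_one,
          Real.norm_of_nonneg (mul_div_sqrt_pos hR hθ0).le,
          Real.norm_of_nonneg hθ'.1.le] at h1
        exact h1
      have hv : (v : EuclideanSpace ℝ (Fin (k + 1))) = θ⁻¹ • b.1.2.1 := by
        rw [hsq, hcoef] at hy
        have := smul_right_injective (EuclideanSpace ℝ (Fin (k + 1))) hθ'.1.ne' hy
        exact this.symm
      refine ⟨v, θ, ⟨hθ0, hθ1⟩, ?_, ?_⟩
      · rw [hv, smul_smul, mul_inv_cancel₀ hθ0.ne', one_smul]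
      · rw [ha, univBall_inv_smul_smul_of_norm_eq_one hR (norm_eq_of_mem_sphere b.1.2.2) hθ0.le,
          hcoef]
    · rintro ⟨v, θ, hθ, hy, ha⟩
      refine ⟨v, R * θ / Real.sqrt (R ^ 2 - 1 + θ ^ 2),
        ⟨mul_div_sqrt_pos hR hθ.1, (mul_div_sqrt_lt_one_iff hR hθ.1.le).2 hθ.2⟩,
        ?_, ?_⟩
      · rw [hy, univBall_inv_smul_smul_of_norm_eq_one hR (norm_eq_of_mem_sphere v) hθ.1.le]
      · rw [ha, univBall_inv_smul_smul_of_norm_eq_one hR (norm_eq_of_mem_sphere b.1.2.2) hθ.1.le]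

/-- **Squeezed tubes, packaged**: if `P` is obtained from `X` by surgery along `φ`, then for
every `R > 1` there is a framed family `φ'` with the same core spheres, `φ'(v, w) = φ(v, w)` for
`‖w‖ = 1`, whose tubes are the `R`-tubes of `φ` and whose closed unit tubes are the closed unit
tubes of `φ`, along which `P` is still obtained from `X` by surgery.
[cite: MilnorHCobordism1965, Def. 3.11 (PDF p. 17)] -/
theorem IsSurgery.exists_squeeze (hν : ν.IsSurgery IP P) (hR : 1 < R) :
    ∃ ν' : FramedSphereFamily IX X ι k (l + 1),
      (∀ i v w, ν'.toFun i (v, w) =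
        ν.toFun i (v, univBall (0 : EuclideanSpace ℝ (Fin (l + 1))) R
          ((Real.sqrt (R ^ 2 - 1))⁻¹ • w))) ∧
      (∀ i, range (ν'.toFun i) = ν.toFun i '' (univ ×ˢ ball 0 R)) ∧
      (∀ i, ν'.sphere i = ν.sphere i) ∧
      (∀ i v w, ‖w‖ ≤ 1 → ∃ w', ‖w'‖ ≤ 1 ∧ ν'.toFun i (v, w) = ν.toFun i (v, w')) ∧
      ν'.IsSurgery IP P := by
  obtain ⟨ν', h, hr⟩ := ν.exists_squeeze hR
  exact ⟨ν', h, hr, fun i => sphere_eq_of_squeeze h i,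
    fun i v w hw => ⟨_, norm_univBall_inv_smul_le_one hR hw, h i v w⟩, hν.of_squeeze h hR⟩

end FramedSphereFamily

end SqueezeSurgery

end Literature.Topology.FourManifolds

end
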